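import Mathlib
import Literature.NumberTheory.LFunctions.WeilSmallSupportPositivity
import HarnessLib
import Summits.RiemannHypothesis.RiemannHypothesis.Theorems.IntegerScrewCSharpLower

/-!
# Route `IntegerScrew` — THEOREM C♯, upper half: the ELEMENTARY ESTIMATES (prime sums, the room lemma, the
# per-term bounds and the pairing) used by `IntegerScrewCSharpUpper`

Split from `IntegerScrewCSharpUpper` (≤ 400 lines per file).  Contents: `ccpK_sub_mul_exp_le` (and the tree's `Literature.NumberTheory.LFunctions.Real.log_le_half`),
`log_div_natCast_le_half`, `sum_primes_log_div_mul_pred_le_eight` (`Σ_q log q/(q(q−1)) ≤ 8`), `room_sub_nonneg`,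
`birthChiW_bounds`, `term_one_le`, `term_le_four`, `inner_sum_le`, `pairing_le` (CONTINUUM-LIMIT 16.5 (f)),
`sum_primeFactors_weight_le` (`Σ_{p∣x} v_p(log p)²/p ≤ L/2`), `sum_ite_dvd_eq_sum_primeFactors_ite`.
RH-free; nothing here bears on the truth of RH.  References: CONTINUUM-LIMIT §16.4–16.5; PIVOT-LAW 13.44,
13.49–13.53; [Suzuki2023].
-/

noncomputable section

-- D-0017: `Summit.<S>.<S>.…` is the designed namespace of a single-problem summit.
set_option linter.dupNamespace false

namespace Summit.RiemannHypothesis.RiemannHypothesis.Theorems.IntegerScrew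

open Real Finset

/-! ## Elementary facts -/

/-- `K(u,ρ−θ)·e^{−uθ} ≤ K(u,ρ)` for `u > 0`, `θ ≥ 0` (`= A e^{−uθ} + |c|e^{−uρ} ≤ A + |c|e^{−uρ}`). -/
theorem ccpK_sub_mul_exp_le {u : ℝ} (hu : 0 < u) (ρ : ℝ) {θ : ℝ} (hθ : 0 ≤ θ) :
    ccpK u (ρ - θ) * Real.exp (-(u * θ)) ≤ ccpK u ρ := by
  rw [ccpK_eq_ccpA_sub hu.ne', ccpK_eq_ccpA_sub hu.ne', exp_neg_mul_sub]
  have hA := (ccpA_pos hu).le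
  have he1 : Real.exp (-(u * θ)) ≤ 1 := Real.exp_le_one_iff.mpr (by nlinarith)
  have hE : Real.exp (u * θ) * Real.exp (-(u * θ)) = 1 := by rw [← Real.exp_add, add_neg_cancel, Real.exp_zero]
  have e : (ccpA u - ccpc u * (Real.exp (-(u * ρ)) * Real.exp (u * θ))) * Real.exp (-(u * θ)) =
      ccpA u * Real.exp (-(u * θ)) - ccpc u * Real.exp (-(u * ρ)) := by
    calc _ = ccpA u * Real.exp (-(u * θ))
          - ccpc u * Real.exp (-(u * ρ)) * (Real.exp (u * θ) * Real.exp (-(u * θ))) := by ring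
      _ = _ := by rw [hE, mul_one]
  rw [e]
  have := mul_le_mul_of_nonneg_left he1 hA
  linarith

/-- `log p / p ≤ 1/2` for every natural `p`. -/
theorem log_div_natCast_le_half (p : ℕ) : Real.log p / p ≤ 1 / 2 := by
  rcases Nat.eq_zero_or_pos p with rfl | hp
  · simp
  · have hp' : (0 : ℝ) < p := by exact_mod_cast hp
    rw [div_le_iff₀ hp']
    have := Literature.NumberTheory.LFunctions.Real.log_le_half hp'
    linarith

/-- `Σ_{q ≤ Y prime} log q/(q(q−1)) ≤ 8` (`log q/(q(q−1)) ≤ 4/(q√q)`, telescoping). -/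
theorem sum_primes_log_div_mul_pred_le_eight (Y : ℕ) :
    ∑ q ∈ (Finset.Icc 1 Y).filter Nat.Prime, Real.log q / ((q : ℝ) * ((q : ℝ) - 1)) ≤ 8 := by
  rcases Nat.eq_zero_or_pos Y with rfl | hY
  · simp
  calc ∑ q ∈ (Finset.Icc 1 Y).filter Nat.Prime, Real.log q / ((q : ℝ) * ((q : ℝ) - 1))
      ≤ ∑ q ∈ (Finset.Icc 1 Y).filter Nat.Prime, 4 / ((q : ℝ) * Real.sqrt q) := by
        refine Finset.sum_le_sum fun q hq => ?_
        have hq2 : (2 : ℝ) ≤ q := by exact_mod_cast (Finset.mem_filter.mp hq).2.two_le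
        have hq0 : (0 : ℝ) < q := by linarith
        have hlog : Real.log q ≤ 2 * Real.sqrt q := by
          have h := Real.log_le_rpow_div hq0.le one_half_pos
          rw [← Real.sqrt_eq_rpow] at h
          linarith
        have hsq : 0 < Real.sqrt (q : ℝ) := Real.sqrt_pos.mpr hq0
        have hsq2 : Real.sqrt (q : ℝ) * Real.sqrt q = q := Real.mul_self_sqrt hq0.le
        rw [div_le_div_iff₀ (by nlinarith) (by positivity)]
        nlinarith [Real.log_nonneg (by linarith : (1 : ℝ) ≤ q), mul_pos hq0 hsq]
    _ ≤ ∑ n ∈ Finset.Icc 2 Y, 4 / ((n : ℝ) * Real.sqrt n) := by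
        refine Finset.sum_le_sum_of_subset_of_nonneg ?_ fun n _ _ => by positivity
        intro q hq
        have h := Finset.mem_filter.mp hq
        exact Finset.mem_Icc.mpr ⟨h.2.two_le, (Finset.mem_Icc.mp h.1).2⟩
    _ = 4 * ∑ n ∈ Finset.Icc 2 Y, 1 / ((n : ℝ) * Real.sqrt n) := by
        rw [Finset.mul_sum]; refine Finset.sum_congr rfl fun n _ => ?_; ring
    _ ≤ 4 * (2 - 2 / Real.sqrt Y) := by gcongr; exact sum_Icc_two_inv_mul_sqrt_le Y hY
    _ ≤ 8 := by
        have : 0 ≤ 2 / Real.sqrt Y := by positivity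
        linarith

/-- `a·θ_q ≤ ρ_x` when `q^a ≤ M/x`: the room after a birth of `q^a` is non-negative (`2 ≤ M`, `1 ≤ x`, `q` prime,
`a ≤ log_q (M/x)`, `1 ≤ M/x`). -/
theorem room_sub_nonneg {M x q a : ℕ} (hM : 2 ≤ M) (hx : 1 ≤ x) (hxM : x ≤ M) (hq : q.Prime)
    (ha : a ≤ Nat.log q (M / x)) : 0 ≤ room (Real.log M) x - a * (Real.log q / Real.log M) := by
  have hL : 0 < Real.log M := Real.log_pos (by exact_mod_cast (by omega : 1 < M))
  have hx0 : (0 : ℝ) < x := by exact_mod_cast (by omega : 0 < x)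
  have hMx : 1 ≤ M / x := (Nat.one_le_div_iff (by omega)).mpr hxM
  -- q^a ≤ M/x in ℕ, hence (q:ℝ)^a * x ≤ M
  have h1 : q ^ a ≤ M / x := Nat.pow_le_of_le_log (by omega) ha
  have h2 : q ^ a * x ≤ M := (Nat.le_div_iff_mul_le (by omega)).mp h1
  have h3 : ((q : ℝ) ^ a) * x ≤ M := by exact_mod_cast h2
  have hq0 : (0 : ℝ) < q := by exact_mod_cast hq.pos
  -- take logs
  have h4 : a * Real.log q + Real.log x ≤ Real.log M := by
    have := Real.log_le_log (by positivity) h3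
    rwa [Real.log_mul (by positivity) hx0.ne', Real.log_pow] at this
  unfold room
  rw [show 1 - Real.log x / Real.log M - a * (Real.log q / Real.log M) =
    (Real.log M - (a * Real.log q + Real.log x)) / Real.log M by field_simp; ring]
  exact div_nonneg (by linarith) hL.le

/-- `χ′_q ∈ [0, 2]`. -/
theorem birthChiW_bounds {L u : ℝ} (hL : 0 ≤ L) (hu : 0 ≤ u) (x : ℕ) {q : ℕ} (hq : q.Prime) :
    0 ≤ birthChiW L u x q ∧ birthChiW L u x q ≤ 2 := by
  unfold birthChiW
  have hq2 : (2 : ℝ) ≤ q := by exact_mod_cast hq.two_le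
  split_ifs with hqx
  · exact ⟨zero_le_one, by norm_num⟩
  · have hφ0 : 0 ≤ 1 - Real.exp (-(u * (Real.log q / L))) :=
      phi_nonneg hu (div_nonneg (Real.log_natCast_nonneg q) hL)
    have hφ1 := phi_le_one u (Real.log q / L)
    have hw0 : 0 ≤ (q : ℝ) / ((q : ℝ) - 1) := div_nonneg (by linarith) (by linarith)
    have hw2 : (q : ℝ) / ((q : ℝ) - 1) ≤ 2 := by rw [div_le_iff₀ (by linarith)]; linarith
    exact ⟨mul_nonneg hφ0 hw0, by nlinarith⟩

/-! ## Per-term upper bounds for the (q,a)-sum of the `h′` identity -/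

/-- **a = 1**: `(log q/(qL))[K(ρ−θ_q)χ′_q − K] ≤ (log q/(qL))F(θ_q) + 2K log q/(q(q−1)L) + [q ∣ x]·(log q/(qL))K(ρ−θ_q)e^{−uθ_q}`
(`u > 0`, `L > 0`, `θ_q ≤ ρ ≤ 1`). -/
theorem term_one_le {L u : ℝ} (hL : 0 < L) (hu : 0 < u) (x : ℕ) {q : ℕ} (hq : q.Prime) {ρ : ℝ} (hρ1 : ρ ≤ 1)
    (hθρ : Real.log q / L ≤ ρ) :
    Real.log q / ((q : ℝ) ^ 1 * L) * (ccpK u (ρ - (1 : ℕ) * (Real.log q / L)) * birthChiW L u x q - ccpK u ρ) ≤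
      Real.log q / ((q : ℝ) * L) *
          (ccpK u (ρ - Real.log q / L) * (1 - Real.exp (-(u * (Real.log q / L)))) - ccpK u ρ)
        + 2 * ccpK u ρ * (Real.log q / ((q : ℝ) * ((q : ℝ) - 1) * L))
        + (if q ∣ x then Real.log q / ((q : ℝ) * L) * (ccpK u (ρ - Real.log q / L) * Real.exp (-(u * (Real.log q / L))))
           else 0) := by
  rw [pow_one, Nat.cast_one, one_mul]
  have hq2 : (2 : ℝ) ≤ q := by exact_mod_cast hq.two_le
  have hq0 : (0 : ℝ) < q := by linarith
  have hθ0 : 0 ≤ Real.log q / L := div_nonneg (Real.log_natCast_nonneg q) hL.le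
  have hw : 0 ≤ Real.log q / ((q : ℝ) * L) := by positivity
  have hKθ := (ccpK_pos hu (ρ - Real.log q / L)).le
  have hK0 : ccpK u (ρ - Real.log q / L) ≤ 2 * ccpK u ρ :=
    (ccpK_sub_le_ccpK_zero hu hθρ).trans (ccpK_zero_le_two_mul_ccpK hu hρ1)
  have hφ1 := phi_le_one u (Real.log q / L)
  have hφ0 : 0 ≤ 1 - Real.exp (-(u * (Real.log q / L))) := phi_nonneg hu.le hθ0
  have hextra : 0 ≤ 2 * ccpK u ρ * (Real.log q / ((q : ℝ) * ((q : ℝ) - 1) * L)) := by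
    have := (ccpK_pos hu ρ).le
    have hq1 : 0 ≤ (q : ℝ) - 1 := by linarith
    have : 0 ≤ Real.log q / ((q : ℝ) * ((q : ℝ) - 1) * L) :=
      div_nonneg (Real.log_natCast_nonneg q) (mul_nonneg (mul_nonneg hq0.le hq1) hL.le)
    positivity
  unfold birthChiW
  split_ifs with hqx
  · -- present prime: χ′ = 1; K(ρ−θ) − K = F + K(ρ−θ)e^{−uθ}
    rw [mul_one]
    have e : ccpK u (ρ - Real.log q / L) - ccpK u ρ =
        (ccpK u (ρ - Real.log q / L) * (1 - Real.exp (-(u * (Real.log q / L)))) - ccpK u ρ)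
          + ccpK u (ρ - Real.log q / L) * Real.exp (-(u * (Real.log q / L))) := by ring
    rw [e, mul_add]
    linarith
  · -- new prime: χ′ = φ·q/(q−1); the extra is K(ρ−θ)φ/(q−1) ≤ 2K/(q−1)
    have hq1 : (0 : ℝ) < (q : ℝ) - 1 := by linarith
    have e : ccpK u (ρ - Real.log q / L) * ((1 - Real.exp (-(u * (Real.log q / L)))) * ((q : ℝ) / ((q : ℝ) - 1)))
          - ccpK u ρ =
        (ccpK u (ρ - Real.log q / L) * (1 - Real.exp (-(u * (Real.log q / L)))) - ccpK u ρ)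
          + ccpK u (ρ - Real.log q / L) * (1 - Real.exp (-(u * (Real.log q / L)))) / ((q : ℝ) - 1) := by
      field_simp
      ring
    rw [e, mul_add, add_zero]
    have hKφ : ccpK u (ρ - Real.log q / L) * (1 - Real.exp (-(u * (Real.log q / L)))) ≤ 2 * ccpK u ρ := by
      have := mul_le_of_le_one_right hKθ hφ1
      linarith
    have h2 : Real.log q / ((q : ℝ) * L) *
        (ccpK u (ρ - Real.log q / L) * (1 - Real.exp (-(u * (Real.log q / L)))) / ((q : ℝ) - 1)) ≤
        2 * ccpK u ρ * (Real.log q / ((q : ℝ) * ((q : ℝ) - 1) * L)) := by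
      rw [show 2 * ccpK u ρ * (Real.log q / ((q : ℝ) * ((q : ℝ) - 1) * L)) =
        Real.log q / ((q : ℝ) * L) * (2 * ccpK u ρ / ((q : ℝ) - 1)) by field_simp]
      exact mul_le_mul_of_nonneg_left (div_le_div_of_nonneg_right hKφ hq1.le) hw
    linarith

/-- **a ≥ 2** (any `a` with non-negative room): `(log q/(q^aL))[K(ρ−aθ_q)χ′ − K] ≤ 4K·log q/(q^aL)`. -/
theorem term_le_four {L u : ℝ} (hL : 0 < L) (hu : 0 < u) (x : ℕ) {q : ℕ} (hq : q.Prime) (a : ℕ) {ρ : ℝ}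
    (hρ1 : ρ ≤ 1) (hroom : 0 ≤ ρ - a * (Real.log q / L)) :
    Real.log q / ((q : ℝ) ^ a * L) * (ccpK u (ρ - a * (Real.log q / L)) * birthChiW L u x q - ccpK u ρ) ≤
      4 * ccpK u ρ * (Real.log q / ((q : ℝ) ^ a * L)) := by
  have hq0 : (0 : ℝ) < q := by exact_mod_cast hq.pos
  have hw : 0 ≤ Real.log q / ((q : ℝ) ^ a * L) := by positivity
  obtain ⟨hχ0, hχ2⟩ := birthChiW_bounds hL.le hu.le x hq
  have hKa : ccpK u (ρ - a * (Real.log q / L)) ≤ 2 * ccpK u ρ := by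
    have h1 : ccpK u (ρ - a * (Real.log q / L)) ≤ ccpK u 0 := ccpK_le_ccpK_zero_of_nonneg hu hroom
    exact h1.trans (ccpK_zero_le_two_mul_ccpK hu hρ1)
  have hKa0 := (ccpK_pos hu (ρ - a * (Real.log q / L))).le
  have hK := (ccpK_pos hu ρ).le
  have hb : ccpK u (ρ - a * (Real.log q / L)) * birthChiW L u x q - ccpK u ρ ≤ 4 * ccpK u ρ := by
    nlinarith [mul_le_mul hKa hχ2 hχ0 (by linarith)]
  calc Real.log q / ((q : ℝ) ^ a * L) * (ccpK u (ρ - a * (Real.log q / L)) * birthChiW L u x q - ccpK u ρ)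
      ≤ Real.log q / ((q : ℝ) ^ a * L) * (4 * ccpK u ρ) := mul_le_mul_of_nonneg_left hb hw
    _ = 4 * ccpK u ρ * (Real.log q / ((q : ℝ) ^ a * L)) := by ring

/-- The inner `a`-sum for one prime `q ≤ M/x`, bounded above. -/
theorem inner_sum_le {M x q : ℕ} (hM : 2 ≤ M) (hx : 1 ≤ x) (hxM : x ≤ M) (hq : q.Prime) (hqM : q ≤ M / x)
    {u : ℝ} (hu : 0 < u) :
    ∑ a ∈ Finset.Icc 1 (Nat.log q (M / x)), Real.log q / ((q : ℝ) ^ a * Real.log M) *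
        (ccpK u (room (Real.log M) x - a * (Real.log q / Real.log M)) * birthChiW (Real.log M) u x q
          - ccpK u (room (Real.log M) x)) ≤
      Real.log q / ((q : ℝ) * Real.log M) *
          (ccpK u (room (Real.log M) x - Real.log q / Real.log M) * (1 - Real.exp (-(u * (Real.log q / Real.log M))))
            - ccpK u (room (Real.log M) x))
        + 2 * ccpK u (room (Real.log M) x) * (Real.log q / ((q : ℝ) * ((q : ℝ) - 1) * Real.log M))
        + (if q ∣ x then Real.log q / ((q : ℝ) * Real.log M) *
            (ccpK u (room (Real.log M) x - Real.log q / Real.log M) * Real.exp (-(u * (Real.log q / Real.log M))))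
           else 0)
        + 4 * ccpK u (room (Real.log M) x) / Real.log M * ∑ a ∈ Finset.Icc 2 (Nat.log q (M / x)), Real.log q / (q : ℝ) ^ a := by
  set L := Real.log M with hLdef
  set ρ := room L x with hρdef
  have hL : 0 < L := Real.log_pos (by exact_mod_cast (by omega : 1 < M))
  have hρ1 : ρ ≤ 1 := by
    rw [hρdef]; unfold room
    have : 0 ≤ Real.log x / L := div_nonneg (Real.log_nonneg (by exact_mod_cast hx)) hL.le
    linarith
  have hA : 1 ≤ Nat.log q (M / x) := by
    rw [Nat.one_le_iff_ne_zero, ne_eq, Nat.log_eq_zero_iff, not_or, not_lt]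
    exact ⟨hqM, by have := hq.two_le; omega⟩
  rw [← Finset.add_sum_Ioc_eq_sum_Icc hA, show Finset.Ioc 1 (Nat.log q (M / x)) = Finset.Icc 2 (Nat.log q (M / x)) by
    ext a; simp only [Finset.mem_Ioc, Finset.mem_Icc]; omega]
  have hθρ : Real.log q / L ≤ ρ := by
    have := room_sub_nonneg (a := 1) hM hx hxM hq hA
    rw [Nat.cast_one, one_mul] at this
    rw [hρdef]; linarith
  have h1 := term_one_le hL hu x hq hρ1 hθρ
  have h2 : ∑ a ∈ Finset.Icc 2 (Nat.log q (M / x)), Real.log q / ((q : ℝ) ^ a * L) *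
        (ccpK u (ρ - a * (Real.log q / L)) * birthChiW L u x q - ccpK u ρ) ≤
      4 * ccpK u ρ / L * ∑ a ∈ Finset.Icc 2 (Nat.log q (M / x)), Real.log q / (q : ℝ) ^ a := by
    rw [Finset.mul_sum]
    refine Finset.sum_le_sum fun a ha => ?_
    have haA : a ≤ Nat.log q (M / x) := (Finset.mem_Icc.mp ha).2
    have := term_le_four hL hu x hq a hρ1 (room_sub_nonneg hM hx hxM hq haA)
    calc _ ≤ 4 * ccpK u ρ * (Real.log q / ((q : ℝ) ^ a * L)) := this
      _ = 4 * ccpK u ρ / L * (Real.log q / (q : ℝ) ^ a) := by field_simp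
  linarith

/-! ## The pairing of a present prime's extra term with its full-death term (16.5 (f)) -/

/-- For `p ∣ x` (`x ≥ 1`, `u > 0`, `L > 0`, `ρ_x ≥ 0`):
`Π(u;x)·[p ≤ M/x]·(θ_p/p)K(ρ−θ_p)e^{−uθ_p} − (θ_p/p)·h̃(u; x/p^{v_p}) ≤ Π(u;x)·(θ_p/p)·u·v_pθ_p·|c(u)|`. -/
theorem pairing_le {L u : ℝ} (hL : 0 < L) (hu : 0 < u) {x p : ℕ} (hx : x ≠ 0) (hp : p.Prime) (hpx : p ∣ x)
    (hρ : 0 ≤ room L x) (b : Prop) [Decidable b] :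
    primeProd L u x * (if b then Real.log p / ((p : ℝ) * L) *
        (ccpK u (room L x - Real.log p / L) * Real.exp (-(u * (Real.log p / L)))) else 0)
      - Real.log p / L / p * hTilde L u (x / p ^ x.factorization p) ≤
      primeProd L u x * (Real.log p / ((p : ℝ) * L) * (u * (x.factorization p * (Real.log p / L)) * |ccpc u|)) := by
  have hp0 : (0 : ℝ) < p := by exact_mod_cast hp.pos
  have hθ0 : 0 ≤ Real.log p / L := div_nonneg (Real.log_natCast_nonneg p) hL.le
  have hw : 0 ≤ Real.log p / ((p : ℝ) * L) := by positivity
  have hPi : 0 ≤ primeProd L u x := primeProd_nonneg hL.le hu.le x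
  have hφ0 : 0 ≤ 1 - Real.exp (-(u * (Real.log p / L))) := phi_nonneg hu.le hθ0
  have hφ1 := phi_le_one u (Real.log p / L)
  -- h̃(x/p^v) ≥ h̃(x/p^v)·φ = K(ρ + vθ)Π
  have hfull := hTilde_ordCompl_mul L u hx hp hpx
  have hh0 : 0 ≤ hTilde L u (x / p ^ x.factorization p) := by
    unfold hTilde; exact mul_nonneg (ccpK_pos hu _).le (primeProd_nonneg hL.le hu.le _)
  have hlow : ccpK u (room L x + x.factorization p * (Real.log p / L)) * primeProd L u x ≤
      hTilde L u (x / p ^ x.factorization p) := by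
    rw [← hfull]; exact mul_le_of_le_one_right hh0 hφ1
  -- the birth extra ≤ Π (θ/p) K(ρ)
  have hite : (if b then Real.log p / ((p : ℝ) * L) *
        (ccpK u (room L x - Real.log p / L) * Real.exp (-(u * (Real.log p / L)))) else 0) ≤
      Real.log p / ((p : ℝ) * L) * ccpK u (room L x) := by
    split_ifs
    · exact mul_le_mul_of_nonneg_left (ccpK_sub_mul_exp_le hu _ hθ0) hw
    · exact mul_nonneg hw (ccpK_pos hu _).le
  -- Δ = K − K(ρ+vθ) ≤ u vθ |c|
  have hΔ : ccpK u (room L x) - ccpK u (room L x + x.factorization p * (Real.log p / L)) ≤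
      u * (x.factorization p * (Real.log p / L)) * |ccpc u| :=
    ccpK_sub_ccpK_add_le hu hρ (mul_nonneg (Nat.cast_nonneg _) hθ0)
  have e1 : Real.log p / L / p = Real.log p / ((p : ℝ) * L) := by field_simp
  rw [e1]
  have := mul_le_mul_of_nonneg_left hite hPi
  have := mul_le_mul_of_nonneg_left hlow hw
  nlinarith [mul_le_mul_of_nonneg_left hΔ (mul_nonneg hPi hw)]

/-- The pairing weights sum to at most `(1 − ρ_x)/(2L)`:
`Σ_{p ∈ primeFactors x} (log p/(pL))·(v_p·(log p/L)) ≤ (1 − ρ_x)/(2L)` (`log p/p ≤ ½`, `Σ_p v_pθ_p = 1 − ρ_x`). -/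
theorem sum_primeFactors_weight_le {L : ℝ} (hL : 0 < L) (x : ℕ) :
    ∑ p ∈ x.primeFactors, Real.log p / ((p : ℝ) * L) * (x.factorization p * (Real.log p / L)) ≤
      (1 - room L x) / (2 * L) := by
  have e : (1 - room L x) / (2 * L) =
      ∑ p ∈ x.primeFactors, (1 / (2 * L)) * ((x.factorization p : ℝ) * (Real.log p / L)) := by
    rw [← Finset.mul_sum, sum_factorization_mul_theta]
    field_simp
  rw [e]
  refine Finset.sum_le_sum fun p hp => ?_
  have hpp := Nat.prime_of_mem_primeFactors hp
  have hp0 : (0 : ℝ) < p := by exact_mod_cast hpp.pos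
  have hθ : 0 ≤ (x.factorization p : ℝ) * (Real.log p / L) :=
    mul_nonneg (Nat.cast_nonneg _) (div_nonneg (Real.log_natCast_nonneg p) hL.le)
  have h := log_div_natCast_le_half p
  have e2 : Real.log p / ((p : ℝ) * L) = (Real.log p / p) * (1 / L) := by
    field_simp
  rw [e2, mul_assoc]
  rw [show (1 : ℝ) / (2 * L) * ((x.factorization p : ℝ) * (Real.log p / L)) =
    (1 / 2) * ((1 / L) * ((x.factorization p : ℝ) * (Real.log p / L))) by field_simp]
  exact mul_le_mul_of_nonneg_right h (mul_nonneg (by positivity) hθ)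

/-! ## The assembled upper bound of 16.5 (UNCONDITIONAL, `ε⁺_L = 65/L`) -/

/-- The present primes `≤ M/x` as a filter of the primes `≤ M/x` and as a filter of `primeFactors x`. -/
theorem sum_ite_dvd_eq_sum_primeFactors_ite {M x : ℕ} (hx : x ≠ 0) (g : ℕ → ℝ) :
    ∑ q ∈ (Finset.Icc 1 (M / x)).filter Nat.Prime, (if q ∣ x then g q else 0) =
      ∑ p ∈ x.primeFactors, (if p ≤ M / x then g p else 0) := by
  rw [← Finset.sum_filter, ← Finset.sum_filter]
  refine Finset.sum_congr ?_ fun _ _ => rfl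
  ext q
  simp only [Finset.mem_filter, Finset.mem_Icc, Nat.mem_primeFactors]
  constructor
  · rintro ⟨⟨⟨_, hqM⟩, hq⟩, hqx⟩; exact ⟨⟨hq, hqx, hx⟩, hqM⟩
  · rintro ⟨⟨hq, hqx, _⟩, hqM⟩; exact ⟨⟨⟨hq.one_lt.le, hqM⟩, hq⟩, hqx⟩

end Summit.RiemannHypothesis.RiemannHypothesis.Theorems.IntegerScrew

end
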